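import Mathlib
import Summits.Ventures.PercRepro2.TypedHarrisSpectator

/-!
# Reflection–Harris with a spectator: pair events of the two non-spectator copies
(blind cell PercRepro2, p3 g9, 2026-08-26; `proofs/P3-SWITCH.md` §5 — the engine lemma of the
«box» family of the typed S2 calculus)

For a fixed third copy `w` (the SPECTATOR) the typed pairs `(x, y)` form the DAD fibre
`x = cfg (Z ∪ r)`, `y = cfg (Z ∪ (A ∖ r))`, `r ⊆ A` (`Hub.sum_typed_fibre`).  An event of the PAIR
that is increasing in `x` and decreasing in `y` — here `P(x) ∧ ¬Q(y)` for increasing `P, Q` — is an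
up-set of the fibre lattice; so is `S(x) ∧ ¬R(y)`.  Harris on the fibre (`DAD.fibreHarris`) applied
to these two up-sets, the second one evaluated at the REFLECTED point `A ∖ r` (which exchanges `x`
and `y`), gives

  `Σ 1_P(x) 1_{¬Q}(y) · 1_{¬R}(x) 1_S(y)  ≤  Σ 1_P(x) 1_{¬Q}(y) · 1_S(x) 1_{¬R}(y)`

over the typed pairs of `w` (`fibre_pair_harris`), hence with a nonnegative spectator weight
(`typedCount_pair_harris_spectator`).  On states (a monotone state map `σ`, four states
`α δ β γ`): the typed count of `g(σ w)·1[α ≤ σ x ≤ δ]·1[β ≤ σ y ≤ γ]` is at most that of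
`g(σ w)·1[α ≤ σ x ∧ β ≤ σ x]·1[σ y ≤ γ ∧ σ y ≤ δ]` (`typedCount_box_le`) — the «box» inequality,
of which the per-copy typed-Harris-with-spectator slack (`TypedHarris.typedCount_harris_spectator`)
is the case of a trivial `y`-interval.  Own work; standard axioms.
-/

namespace Summit.Ventures.PercRepro2

namespace CovForm

namespace PairHarris

open Hub

section Fibre

open Classical

variable {E : Type*} [Fintype E] [DecidableEq E] {R : Type*} [Field R] [LinearOrder R]
  [IsStrictOrderedRing R]

omit [Fintype E] in
/-- The pair event `P(cfg Y) ∧ ¬Q(cfg (Z ∪ (A ∖ (Y ∖ Z))))` — increasing in the first copy,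
decreasing in the reflected copy — is an up-set of edge sets. -/
lemma isUpperSet_pair_preimage (Z A : Finset E) {P Q : Set (Config E)} (hP : IsUpperSet P)
    (hQ : IsUpperSet Q) :
    IsUpperSet {Y : Finset E | cfg Y ∈ P ∧ cfg (Z ∪ (A \ (Y \ Z))) ∉ Q} := by
  intro Y Y' hYY' hY
  refine ⟨hP (cfg_mono hYY') hY.1, fun hq => hY.2 (hQ (cfg_mono ?_) hq)⟩
  exact Finset.union_subset_union (le_refl Z)
    (Finset.sdiff_subset_sdiff (le_refl A) (Finset.sdiff_subset_sdiff hYY' (le_refl Z)))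

omit [Fintype E] in
/-- `(Z ∪ r) ∖ Z = r` when `r` is disjoint from `Z`. -/
lemma union_sdiff_self_of_disjoint {Z r : Finset E} (h : Disjoint Z r) : (Z ∪ r) \ Z = r :=
  Finset.union_sdiff_cancel_left h

/-- **Reflection–Harris on one fibre.**  For increasing events `P, Q, U, V` of configurations,
over the typed pairs `(x, y)` of the spectator `w`:
`Σ 1_P(x)·1_{¬Q}(y)·(1_{¬U}(x)·1_V(y)) ≤ Σ 1_P(x)·1_{¬Q}(y)·(1_V(x)·1_{¬U}(y))`. -/
theorem fibre_pair_harris (F : Finset E) (z : Config E) (τ : E → ℕ) (w : Config E)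
    (hτ : ∀ e ∈ F, τ e = 1 ∨ τ e = 2) (hw : ∀ e, e ∉ F → w e = z e)
    (P Q U V : Set (Config E)) (hP : IsUpperSet P) (hQ : IsUpperSet Q) (hU : IsUpperSet U)
    (hV : IsUpperSet V) :
    ∑ p ∈ pairSet F z τ w, (P.indicator (1 : Config E → R) p.1 * Qᶜ.indicator 1 p.2) *
        (Uᶜ.indicator (1 : Config E → R) p.1 * V.indicator 1 p.2) ≤
      ∑ p ∈ pairSet F z τ w, (P.indicator (1 : Config E → R) p.1 * Qᶜ.indicator 1 p.2) *
        (V.indicator (1 : Config E → R) p.1 * Uᶜ.indicator 1 p.2) := by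
  rw [sum_typed_fibre F z τ w hτ hw (fun x y =>
      (P.indicator (1 : Config E → R) x * Qᶜ.indicator 1 y) *
        (Uᶜ.indicator (1 : Config E → R) x * V.indicator 1 y)),
    sum_typed_fibre F z τ w hτ hw (fun x y =>
      (P.indicator (1 : Config E → R) x * Qᶜ.indicator 1 y) *
        (V.indicator (1 : Config E → R) x * Uᶜ.indicator 1 y))]
  have hdisj : Disjoint (Zset F z τ w) (Aset F τ w) := disjoint_Zset_Aset F z τ w
  have h := DAD.fibreHarris (R := R) (Aset F τ w) (Zset F z τ w) (Zset F z τ w) hdisj hdisj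
    {Y : Finset E | cfg Y ∈ P ∧ cfg (Zset F z τ w ∪ (Aset F τ w \ (Y \ Zset F z τ w))) ∉ Q}
    {Y : Finset E | cfg Y ∈ V ∧ cfg (Zset F z τ w ∪ (Aset F τ w \ (Y \ Zset F z τ w))) ∉ U}
    (isUpperSet_pair_preimage _ _ hP hQ) (isUpperSet_pair_preimage _ _ hV hU)
  simp only [Finset.union_self] at h
  refine le_trans (le_of_eq ?_) (h.trans (le_of_eq ?_))
  · refine Finset.sum_congr rfl fun r hr => ?_
    have hr' : r ⊆ Aset F τ w := Finset.mem_powerset.1 hr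
    have e1 : (Zset F z τ w ∪ r) \ Zset F z τ w = r :=
      union_sdiff_self_of_disjoint (Finset.disjoint_of_subset_right hr' hdisj)
    have e2 : (Zset F z τ w ∪ (Aset F τ w \ r)) \ Zset F z τ w = Aset F τ w \ r :=
      union_sdiff_self_of_disjoint (Finset.disjoint_of_subset_right Finset.sdiff_subset hdisj)
    have e3 : Aset F τ w \ (Aset F τ w \ r) = r := Finset.sdiff_sdiff_eq_self hr'
    simp only [xOf, yOf, Set.indicator_apply, Set.mem_setOf_eq, Set.mem_compl_iff, Pi.one_apply,
      e1, e2, e3]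
    by_cases hp : cfg (Zset F z τ w ∪ r) ∈ P <;>
      by_cases hq : cfg (Zset F z τ w ∪ (Aset F τ w \ r)) ∈ Q <;>
      by_cases hr2 : cfg (Zset F z τ w ∪ r) ∈ U <;>
      by_cases hs : cfg (Zset F z τ w ∪ (Aset F τ w \ r)) ∈ V <;>
      simp [hp, hq, hr2, hs]
  · refine Finset.sum_congr rfl fun r hr => ?_
    have hr' : r ⊆ Aset F τ w := Finset.mem_powerset.1 hr
    have e1 : (Zset F z τ w ∪ r) \ Zset F z τ w = r :=
      union_sdiff_self_of_disjoint (Finset.disjoint_of_subset_right hr' hdisj)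
    simp only [xOf, yOf, Set.indicator_apply, Set.mem_setOf_eq, Set.mem_inter_iff,
      Set.mem_compl_iff, Pi.one_apply, e1]
    by_cases hp : cfg (Zset F z τ w ∪ r) ∈ P <;>
      by_cases hq : cfg (Zset F z τ w ∪ (Aset F τ w \ r)) ∈ Q <;>
      by_cases hr2 : cfg (Zset F z τ w ∪ (Aset F τ w \ r)) ∈ U <;>
      by_cases hs : cfg (Zset F z τ w ∪ r) ∈ V <;>
      simp [hp, hq, hr2, hs]

/-- **Reflection–Harris with a spectator**: for increasing events `P, Q, U, V` and a nonnegative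
spectator weight `f` on the third copy, on every minor and every type map with values in `{1, 2}`. -/
theorem typedCount_pair_harris_spectator (F : Finset E) (z : Config E) (τ : E → ℕ)
    (hτ : ∀ e ∈ F, τ e = 1 ∨ τ e = 2) (f : Config E → R) (hf : ∀ w, 0 ≤ f w)
    (P Q U V : Set (Config E)) (hP : IsUpperSet P) (hQ : IsUpperSet Q) (hU : IsUpperSet U)
    (hV : IsUpperSet V) :
    typedCount F z τ (fun x y w => f w * ((P.indicator (1 : Config E → R) x * Qᶜ.indicator 1 y) *
        (Uᶜ.indicator (1 : Config E → R) x * V.indicator 1 y))) ≤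
      typedCount F z τ (fun x y w => f w * ((P.indicator (1 : Config E → R) x * Qᶜ.indicator 1 y) *
        (V.indicator (1 : Config E → R) x * Uᶜ.indicator 1 y))) := by
  rw [typedCount_eq_sum_tset, typedCount_eq_sum_tset, sum_tset_third, sum_tset_third]
  refine Finset.sum_le_sum fun w _ => ?_
  dsimp only
  rw [← Finset.mul_sum, ← Finset.mul_sum]
  by_cases hw : ∀ e, e ∉ F → w e = z e
  · exact mul_le_mul_of_nonneg_left (fibre_pair_harris F z τ w hτ hw P Q U V hP hQ hU hV) (hf w)
  · rw [TypedHarris.pairSet_eq_empty F z τ w hw]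
    simp

end Fibre

section States

open Classical

variable {E : Type*} [Fintype E] [DecidableEq E] {R : Type*} [Field R] [LinearOrder R]
  [IsStrictOrderedRing R]

/-- **The box inequality on states.**  For a monotone state map `σ`, four states `α δ β γ` of a
preorder and a nonnegative spectator function `g` of the third copy's state: the typed count of
`g(σ w)·1[α ≤ σ x ∧ σ x ≤ δ]·1[β ≤ σ y ∧ σ y ≤ γ]` is at most the typed count of
`g(σ w)·1[α ≤ σ x ∧ β ≤ σ x]·1[σ y ≤ γ ∧ σ y ≤ δ]`.  (In a lattice of states the right side reads
`1[α ⊔ β ≤ σ x]·1[σ y ≤ γ ⊓ δ]`.) -/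
theorem typedCount_box_le {S : Type*} [Preorder S] (F : Finset E) (z : Config E)
    (τ : E → ℕ) (hτ : ∀ e ∈ F, τ e = 1 ∨ τ e = 2) (σ : Config E → S) (hσ : Monotone σ)
    (α δ β γ : S) (g : S → R) (hg : ∀ s, 0 ≤ g s) :
    typedCount F z τ (fun x y w => g (σ w) *
        ((if α ≤ σ x ∧ σ x ≤ δ then (1 : R) else 0) *
          (if β ≤ σ y ∧ σ y ≤ γ then (1 : R) else 0))) ≤
      typedCount F z τ (fun x y w => g (σ w) *
        ((if α ≤ σ x ∧ β ≤ σ x then (1 : R) else 0) *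
          (if σ y ≤ γ ∧ σ y ≤ δ then (1 : R) else 0))) := by
  -- the four increasing events: `P = {α ≤ σ x}`, `Q = {¬ σ x ≤ γ}`, `R = {¬ σ x ≤ δ}`, `S = {β ≤ σ x}`
  have hP : IsUpperSet {x : Config E | decide (α ≤ σ x) = true} := by
    intro x x' hx hxP
    simp only [Set.mem_setOf_eq, decide_eq_true_eq] at hxP ⊢
    exact hxP.trans (hσ hx)
  have hQ : IsUpperSet {x : Config E | decide (¬ σ x ≤ γ) = true} := by
    intro x x' hx hxQ
    simp only [Set.mem_setOf_eq, decide_eq_true_eq] at hxQ ⊢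
    exact fun h => hxQ ((hσ hx).trans h)
  have hR : IsUpperSet {x : Config E | decide (¬ σ x ≤ δ) = true} := by
    intro x x' hx hxR
    simp only [Set.mem_setOf_eq, decide_eq_true_eq] at hxR ⊢
    exact fun h => hxR ((hσ hx).trans h)
  have hS : IsUpperSet {x : Config E | decide (β ≤ σ x) = true} := by
    intro x x' hx hxS
    simp only [Set.mem_setOf_eq, decide_eq_true_eq] at hxS ⊢
    exact hxS.trans (hσ hx)
  have h := typedCount_pair_harris_spectator F z τ hτ (fun w => g (σ w)) (fun w => hg (σ w))
    {x : Config E | decide (α ≤ σ x) = true} {x : Config E | decide (¬ σ x ≤ γ) = true}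
    {x : Config E | decide (¬ σ x ≤ δ) = true} {x : Config E | decide (β ≤ σ x) = true}
    hP hQ hR hS
  refine le_trans (le_of_eq ?_) (h.trans (le_of_eq ?_))
  · congr 1
    funext x y w
    congr 1
    simp only [Set.indicator_apply, Set.mem_setOf_eq, Set.mem_compl_iff, Pi.one_apply,
      decide_eq_true_eq]
    by_cases h1 : α ≤ σ x <;> by_cases h2 : σ x ≤ δ <;> by_cases h3 : β ≤ σ y <;>
      by_cases h4 : σ y ≤ γ <;> simp [h1, h2, h3, h4]
  · congr 1
    funext x y w
    congr 1
    simp only [Set.indicator_apply, Set.mem_setOf_eq, Set.mem_compl_iff, Pi.one_apply,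
      decide_eq_true_eq]
    by_cases h1 : α ≤ σ x <;> by_cases h2 : β ≤ σ x <;> by_cases h3 : σ y ≤ γ <;>
      by_cases h4 : σ y ≤ δ <;> simp [h1, h2, h3, h4]

end States

end PairHarris

end CovForm

end Summit.Ventures.PercRepro2
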